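import Summits.BirchSwinnertonDyer.Rank1Residual.X11b.ClassClosureTyped
import Summits.BirchSwinnertonDyer.Rank1Residual.X9.SurjBigImage
import Summits.BirchSwinnertonDyer.Rank1Residual.GaloisImage.TorsionIsoImageObstruction
import Literature.NumberTheory.EllipticCurves.Rank1Residual.GoodOrdinaryPartnerSource
import Literature.NumberTheory.EllipticCurves.BurungaleCastellaSkinner2025.CyclotomicMainTheoremIntegral
import HarnessLib

/-!
# Class X11b = N8/O2 (lane CLASS-CLOSURE, seat `cc-typer-3`, experiment type (3) TRANSPORT SEARCH):
# the CONGRUENCE transport — Emerton–Pollack–Weston's Hida-family transfer of the cyclotomic main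
# conjecture composed with the `p`-adic lever, i.e. `BSD(E,p)` in analytic rank ONE at `p ‖ N`
# WITHOUT Skinner's (ram), from a congruent partner (cell `b2b-bsdres`)

HONEST FRAMING (verbatim, cell `b2b-bsdres`, run/shared/lean/b2b/bsd-rank1-residual/): the goal of
the cell is to DELETE the COMBINATION-SHAPED residual classes for ALL analytic-rank `≤ 1` curves
over `ℚ` — "full BSD formula for every rank `≤ 1` curve in class `C`" assembled STRICTLY from
published theorems — so that the rank-`≤ 1` remainder becomes exactly the CONSTRUCTION-SHAPED
classes, which are TYPED (missing-input Props), NOT attempted; this is not "finishing BSD".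
Lane CLASS-CLOSURE (coordinator ruling 2026-08-21T04:07Z), item (3): "census relations linking
open-class pairs to CLOSED-class pairs: isogeny, quadratic twist, level-lowering congruences, base
change; record the comparison statement each would need → candidate TRANSPORT LEMMAS for provers".
THEOREMS ONLY (no definition, no named fact, no `sorry`); nothing booked; X11b stays
CONSTRUCTION-SHAPED; every theorem is CONDITIONAL on the named published facts in its binders and on
the per-pair inputs it names (a partner, a `μ = 0` certificate, the Schneider certificate).

## What the congruence tables of the lane call for (E3, class N8/O2)

cc-eng-3's screen `HOME/class-closure/N8/congruence-levelchange.tsv` (2026-08-21T05:45Z, v0b, "screened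
at ≤ 86 primes, not Sturm-certified; EVIDENCE only") lists, for 855 of the 3 861 N8 cells of record
(`ClassX11b`, `p ≥ 5`), an elliptic curve `E₁` of level PRIME TO `p` (so GOOD at `p`: the cell is
level-lowerable at `p`, `E[p]` finite at `p`, `p ∣ v_p(Δ_min)`) with `a_ℓ(E₁) ≡ a_ℓ(E) (mod p)` on the
screen — among them **50 of the 138 cells of the atom `¬Ram`** (A3 of rmap-3 g5; all split at `p`;
49 with surjective `ρ̄` at `p = 5`/`7`, one (`84960d1`, image `5Ns`) with the CM partner `288a1`). The
printed mechanism these rows invoke is Emerton–Pollack–Weston, Invent. Math. 163 (2006) Cor. 5.1.4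
/ Thm. 5.1.3 (tree facts `EmertonPollackWeston2006.cor514_transfer_of_goodOrdinary` /
`…_of_multiplicative`, PUBLISHED, typed `5 ≤ p`): Mazur's integral main-conjecture identity WITH
`μ = 0` passes along `E₁[p] ≅ E[p]` to the multiplicative member `f_E` of `H(ρ̄)` — with NO (ram)
hypothesis on `E`. The x11a seat (gen 8) typed the RANK-ZERO composition
(`Literature/…/Rank1Residual/Typed/X11HidaTransfer.lean`) and printed the decisive remark: for elliptic
curves at `p ≥ 5` Skinner's (ram) is a `ρ̄`-INVARIANT, so a `¬Ram` curve has NO congruent elliptic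
curve with (ram); the only printed (ram)-free partner source is Burungale–Castella–Skinner 2025
Thm. 1.1.2 (b) at a GOOD ordinary `p` (tree fact
`BurungaleCastellaSkinner2025.thm112b_charIdeal_eq_padicLFunction_integral`), available inside `H(ρ̄)`
iff `ρ̄` is finite at `p`. THIS FILE types the RANK-ONE composition, which did not exist: on X11b the
transferred identity feeds the `p`-adic LEVER of `X11b/ClassClosureDisegniLever.lean` (Stein–Wuthrich
2013 Thm. 6.1 + Disegni 2020 Thm. 1 + the pair's Schneider certificate) instead of Skinner's Thm. A
— so `BSD(E,p)` for ANY `#Ш_an`, no numerical leading-term valuation, and NO (ram): the ONE printed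
road into N8's `¬Ram` atom (before the lever the rank-one transfer had no consumer worth typing).

## The comparison statement of record (T5 template for cc-eng-2 / cc-eng-3 partner rows)

For an N8 cell `(E, p)` (`ClassX11b W p`, `p ≥ 5`; (ram) NOT required) and a partner row `E₁`:
1. `E₁` GOOD ORDINARY at `p` (`p ∤ N₁`, `p ∤ a_p(E₁)`) — exists only if `p ∣ v_p(Δ_min(E))`;
2. a `Γ_ℚ`-equivariant isomorphism `E₁[p] ≃ E[p]` (irreducible `ρ̄`: traces `a_ℓ` agreeing mod `p` up
   to the Sturm bound of `lcm(N, N₁)` certify it — the screen's 86 primes do NOT);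
3. the partner's INTEGRAL cyclotomic main conjecture WITH `μ = 0`, `GoodOrdinaryCharIdealMuZero W₁ p`
   — sourced here (`goodOrdinaryCharIdealMuZero_of_thm112b`) from BCS 2025 Thm. 1.1.2 (b) given
   (im) for `E₁` (⇐ `ρ̄_{E,p}` onto, transported along the isomorphism, Serre: `X9.bigIm_of_surj`) and
   ONE unit coefficient of `ϖ₁ · L_p(f_{E₁}, α)` (a finite modular-symbol certificate "`μ^an(E₁) = 0`");
   the partner's RANK and BSD status are IRRELEVANT (BCS (b) is rank-free) — partner rows need not be
   CLOSED cells; other admissible sources: the X9 seat's `goodOrdinaryCharIdealMuZero_of_bsdp` /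
   `_of_trivialArithmetic` (rank-0 partners), the Rubin ∘ Greenberg–Vatsal CM route (the `5Ns` row);
4. for `E` SPLIT at `p`: a second multiplicative prime of `E` (Disegni 2020 Thm. 1, hypothesis (∗) —
   on the (ram) atom this is the (ram) prime; on `¬Ram` it is a census bit `nmult ≥ 2`);
5. the pair's Schneider certificate `RegulatorNonvanishingAt W p` (REG-MULT row, H-7 format).
Then `BSD(E,p)` (`bsdp_of_goodOrdinaryPartner_of_surj_of_regulatorNonvanishing`). NOT reached: `¬Ram`
cells with `p ∤ v_p(Δ_min)` ("très ramifié": every weight-two member of `H(ρ̄)` has `p` in its level),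
`¬Ram` split cells with a single multiplicative prime, and everything at `p = 3` (class O2, incl. the
off-locus class `318828a1`): the EPW facts are typed `5 ≤ p` (Hida's freeness, EPW Thm. 2.1.2, printed
for `p ≥ 5`) — cite-only at `3`. Level-lowering AT a (ram) prime `q ≠ p` never helps (the partner keeps
`ρ̄`); quadratic twist = STEP L (`ClassClosureTyped`); isogeny = `bsdp_of_isIsogenous_classX11b`.
Contents: `goodOrdinaryCharIdealMuZero_of_thm112b` (partner SOURCE of any rank);
`bsdp_of_multCharIdealMuZero_of_{nonsplit,split_of_five_le}_of_schneider`,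
`bsdp_of_multCharIdealMuZero_of_regulatorNonvanishing` (the lever fed by the SHAPE for `(E, p)`, no
(ram)); `bsdp_of_transfer_{goodOrdinary,multiplicative}_of_regulatorNonvanishing` (the two EPW facts);
`bsdp_of_goodOrdinaryPartner_of_surj_of_regulatorNonvanishing` (every binder published or finite).

References: [EmertonPollackWeston2006] Cor. 5.1.4, Thm. 5.1.3; [BurungaleCastellaSkinner2025] Thm.
1.1.2 (b); [Skinner2016PacificMC] §3.2–3.3; [SteinWuthrich2013] Thm. 6.1, §4.2; [Disegni2020] Thm. 1
(§1.2) = Thm. 4 (§3.2), (∗); [Miller2011LMS] Def. 1.1; [Serre1972] (open image); Ribet 1990.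
-/

set_option autoImplicit false

noncomputable section

open scoped Classical MatrixGroups ModularForm

open CongruenceSubgroup WeierstrassCurve Literature.NumberTheory.EllipticCurves
  Literature.NumberTheory.EllipticCurves.ModularForms
  Literature.NumberTheory.EllipticCurves.Rank1Residual
  Literature.NumberTheory.EllipticCurves.Rank1Residual.Typed
  Literature.NumberTheory.EllipticCurves.Skinner2016
  Literature.NumberTheory.EllipticCurves.SteinWuthrich2013
  Literature.NumberTheory.EllipticCurves.Disegni2020
  Literature.NumberTheory.EllipticCurves.GreenbergVatsal2000
  Literature.NumberTheory.EllipticCurves.EmertonPollackWeston2006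
  Literature.NumberTheory.EllipticCurves.BurungaleCastellaSkinner2025
  Summit.BirchSwinnertonDyer.Rank1Residual.GaloisImage

namespace Summit.BirchSwinnertonDyer.Rank1Residual.X11b.ClassClosure

/-! ### A partner source of ANY rank: Burungale–Castella–Skinner 2025 Thm. 1.1.2 (b) + `μ = 0` certificate -/
/-- **A good-ordinary curve with big image and ONE unit coefficient of its `p`-adic `L`-function is a
source for the Emerton–Pollack–Weston transfer, whatever its rank.** For `A/ℚ` globally minimal, `p > 3`
good ordinary, `A[p]` irreducible with (im) (`BigIm A p`), Burungale–Castella–Skinner 2025 Thm. 1.1.2 (b)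
(`hB`, PUBLISHED named fact) gives `char_Λ X(A/ℚ_∞) = (g)` with `ι g = ϖ · L_p(f_A, α)` integrally; the
finite certificate `hcert` (some coefficient of `ϖ · L_p(f_A, α)` is a `p`-adic unit, i.e.
`μ^an(A) = 0`) is then `HasUnitContent g` (`hasUnitContent_of_map_eq`). No rank, `L(A,1)`, Selmer or
BSD hypothesis on `A` — unlike the X9 seat's rank-`0` sources of `GoodOrdinaryPartnerSource.lean`.
CONDITIONAL on the fact and the certificate; nothing booked.
[cite: BurungaleCastellaSkinner2025, Thm. 1.1.2 (b) (§1.1, p. 2 of arXiv:2405.00270v2)]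
[cite: EmertonPollackWeston2006, statement 5.1.1 (arXiv:math/0404484 p. 30) (shape only)] -/
theorem goodOrdinaryCharIdealMuZero_of_thm112b (hB : thm112b_charIdeal_eq_padicLFunction_integral)
    (A : WeierstrassCurve ℚ) [A.IsElliptic] [A.IsGloballyMinimal] (p : ℕ) [Fact p.Prime]
    (hp : 3 < p) (hord : GoodOrd A p) (hirr : Irr A p) (him : BigIm A p)
    (hcert : ∀ [NeZero (A.conductorNorm ℤ)] (fA : CuspForm (Gamma0 (A.conductorNorm ℤ)) 2),
        IsNewformOf A fA → ∀ (ϖ : ℚ), (ϖ : ℝ) * A.realPeriodRat = plusPeriod fA →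
      ∃ n : ℕ, ‖PowerSeries.coeff n
        (PowerSeries.C (ϖ : ℚ_[p]) * padicLFunction fA (unitRoot A p : ℚ_[p]))‖ = 1) :
    GoodOrdinaryCharIdealMuZero A p := by
  intro κ γ hκ hγ hγ' _ fA hf ϖ hϖ D
  obtain ⟨htors, g, hchar, hι⟩ := hB A p hp hord hirr him κ γ hκ hγ hγ' fA hf ϖ hϖ D
  exact ⟨htors, g, hchar, hasUnitContent_of_map_eq g _ hι (hcert fA hf ϖ hϖ), hι⟩

/-! ### Class level: the lever fed by the multiplicative main-conjecture SHAPE for `(E, p)` — no (ram) -/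

section Shape

variable (W : WeierstrassCurve ℚ) [W.IsElliptic] [W.IsGloballyMinimal] (p : ℕ) [Fact p.Prime]

/-- **X11b, NON-SPLIT at the odd prime `p`: `BSD(E,p)` from the integral main-conjecture identity with
`μ = 0` for `(E, p)` itself (`hMC : MultiplicativeCharIdealMuZero W p` — the conclusion SHAPE of the
Emerton–Pollack–Weston transfer and of Skinner's Thm. A), Stein–Wuthrich 2013 Thm. 6.1 (`hJ`), SW §4.2
height existence (`hH`), Disegni 2020 Thm. 1 NON-SPLIT clause AT THE PAIR (`hD`, inline), GZK,
modularity, and the pair's Schneider certificate (`hSch`).** Literally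
`X11b.bsdp_of_ram_nonsplit_of_schneider` with Skinner's Thm. A + (ram) replaced by the shape: (ram) is
NOT used. Any `#Ш_an`. CONDITIONAL; nothing booked.
[cite: EmertonPollackWeston2006, Cor. 5.1.4 (arXiv:math/0404484 p. 30)]
[cite: SteinWuthrich2013, Thm. 6.1 (p. 20) and §4.2] [cite: Disegni2020, Thm. 1 (§1.2)]
[cite: Miller2011LMS, Def. 1.1] -/
theorem bsdp_of_multCharIdealMuZero_of_nonsplit_of_schneider (hJ : thm61_nonsplitMultiplicative)
    (hH : exists_isMultCanonical) (hGZK : rank_eq_analyticRank_of_analyticRank_le_one)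
    (hpar : nonempty_modularParametrizationData)
    (hD : ∀ {N : ℕ} [NeZero N] {f : CuspForm (Gamma0 N) 2}, IsNewformOf W f →
      ∀ (ϖ : ℚ), ϖ ≠ 0 → (ϖ : ℝ) * W.realPeriodRat = plusPeriod f →
      ∀ (q : ℚ_[p]), q ≠ 0 → ‖q‖ < 1 → tateJ q = (W.j : ℚ_[p]) →
      ∀ (L : PowerSeries ℚ_[p]), IsMultPAdicLFunctionOf f p (-1) L →
      ∀ (Dh : PAdicHeightData W p), IsMultCanonical Dh q →
        ∃ (s : ℚ) (u : ℤ_[p]ˣ), shaAn W = (s : ℂ) ∧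
          ((ϖ : ℚ) : ℚ_[p]) * PowerSeries.coeff 1 L * padicLog p (cyclotomicGenerator p) *
              (W.torsionOrder : ℚ_[p]) ^ 2 =
            ((u : ℤ_[p]) : ℚ_[p]) * (2 * ((s : ℚ_[p]) * padicRegulator Dh * W.tamagawaProduct)))
    (hX : ClassX11b W p) (hns : ¬ W.HasSplitMultiplicativeReductionAtPrime p)
    (hMC : MultiplicativeCharIdealMuZero W p)
    (hSch : ∀ (q : ℚ_[p]) (Dh : PAdicHeightData W p), q ≠ 0 → ‖q‖ < 1 → tateJ q = (W.j : ℚ_[p]) →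
      IsMultCanonical Dh q → SchneiderConjecture Dh) :
    BSDp W p := by
  obtain ⟨hr, hp2, hmult, -⟩ := hX
  -- data from tree theorems
  obtain ⟨κ, hκ, γ, hγ, hγ'⟩ := exists_isCyclotomic_isTopGenerator_isCyclotomicVariable_holds p
  obtain ⟨D⟩ := W.nonempty_selmerDualData_holds κ γ hγ
  haveI : NeZero (W.conductorNorm ℤ) := ⟨(W.conductorNorm_pos_holds).ne'⟩
  obtain ⟨Dm⟩ := hpar W
  obtain ⟨ϖ, hϖpos, hϖ, -⟩ := Dm.exists_rat_mul_realPeriodRat_eq_plusPeriod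
  obtain ⟨L, hL⟩ := exists_isMultPAdicLFunctionOf_neg_one_of_nonsplit Dm.isNewformOf hmult hns
  obtain ⟨q, ⟨hq0, hq1, hqj⟩, -⟩ := existsUnique_tateJ_eq_of_one_lt_norm
    (one_lt_norm_j_of_hasMultiplicativeReductionAtPrime (W := W) (p := p) hmult)
  obtain ⟨Dh, hDh⟩ := hH W p hp2 hmult hns q hq0 hq1 hqj
  -- (MC=) with `μ = 0` for this data, from the shape
  have hXt : D.IsTorsion := hMC.isTorsion hκ hγ hγ' Dm.isNewformOf D ϖ hϖpos.ne' hϖ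
  obtain ⟨g, w, hchar, -, hw⟩ :=
    hMC.exists_charIdeal_eq_unit_nonsplit hκ hγ hγ' Dm.isNewformOf D ϖ hϖpos.ne' hϖ hns L hL
  -- (D) Disegni Thm. 1, non-split clause, at the pair
  obtain ⟨s, u', hs, hDis⟩ := hD Dm.isNewformOf ϖ hϖpos.ne' hϖ q hq0 hq1 hqj L hL Dh hDh
  exact bsdp_of_nonsplit_of_relativeLeadingTerm_of_schneider W p hJ hGZK hp2 hr hmult hns hq0 hq1 hqj
    hκ hγ hγ' D hXt hchar w hw Dh hDh hs u' hDis (hSch q Dh hq0 hq1 hqj hDh)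

/-- **X11b, SPLIT at `p ≥ 5`: `BSD(E,p)` from the shape `MultiplicativeCharIdealMuZero W p` for
`(E, p)`, Stein–Wuthrich Thm. 6.1 split (`hJ`), the modified §4.2 height (`hH`), Disegni 2020 Thm. 1
SPLIT clause AT THE PAIR (`hD`, inline, under its hypothesis (∗): `p ≥ 5` and a second
multiplicative prime `hm` — an EXPLICIT per-pair hypothesis here, since (ram) is not assumed), GZK,
modularity, `𝓛_p ≠ 0` (tree theorem) and the pair's Schneider certificate.** Literally
`X11b.bsdp_of_ram_split_of_five_le_of_schneider` with Skinner's Thm. A + (ram) replaced by the shape.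
CONDITIONAL; nothing booked. [cite: EmertonPollackWeston2006, Cor. 5.1.4 (arXiv:math/0404484 p. 30)]
[cite: SteinWuthrich2013, Thm. 6.1 (p. 20) and §4.2] [cite: Disegni2020, Thm. 1 (§1.2), hypothesis (∗)]
[cite: Miller2011LMS, Def. 1.1] -/
theorem bsdp_of_multCharIdealMuZero_of_split_of_five_le_of_schneider (hJ : thm61_splitMultiplicative)
    (hH : exists_isSplitMultCanonical) (hGZK : rank_eq_analyticRank_of_analyticRank_le_one)
    (hpar : nonempty_modularParametrizationData)
    (hD : ∀ {N : ℕ} [NeZero N] {f : CuspForm (Gamma0 N) 2}, IsNewformOf W f →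
      ∀ (ϖ : ℚ), ϖ ≠ 0 → (ϖ : ℝ) * W.realPeriodRat = plusPeriod f →
      5 ≤ p → (∃ (m : ℕ) (_ : Fact m.Prime), m ≠ p ∧ W.HasMultiplicativeReductionAtPrime m) →
      ∀ (Dq : TateParameterData W p) (L : PowerSeries ℚ_[p]), IsSplitMultPAdicLFunctionOf f p L →
      ∀ (Dh : PAdicHeightData W p), IsSplitMultCanonical Dh Dq →
        ∃ (s : ℚ) (u : ℤ_[p]ˣ), shaAn W = (s : ℂ) ∧
          ((ϖ : ℚ) : ℚ_[p]) * PowerSeries.coeff 2 L * padicLog p (cyclotomicGenerator p) ^ 2 *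
              (W.torsionOrder : ℚ_[p]) ^ 2 =
            ((u : ℤ_[p]) : ℚ_[p]) *
              (LInvariant Dq * ((s : ℚ_[p]) * padicRegulator Dh * W.tamagawaProduct)))
    (hX : ClassX11b W p) (hsplit : W.HasSplitMultiplicativeReductionAtPrime p) (hp5 : 5 ≤ p)
    (hm : ∃ (m : ℕ) (_ : Fact m.Prime), m ≠ p ∧ W.HasMultiplicativeReductionAtPrime m)
    (hMC : MultiplicativeCharIdealMuZero W p)
    (hSch : ∀ (Dq : TateParameterData W p) (Dh : PAdicHeightData W p),
      IsSplitMultCanonical Dh Dq → SchneiderConjecture Dh) :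
    BSDp W p := by
  obtain ⟨hr, hp2, -, -⟩ := hX
  obtain ⟨κ, hκ, γ, hγ, hγ'⟩ := exists_isCyclotomic_isTopGenerator_isCyclotomicVariable_holds p
  obtain ⟨D⟩ := W.nonempty_selmerDualData_holds κ γ hγ
  haveI : NeZero (W.conductorNorm ℤ) := ⟨(W.conductorNorm_pos_holds).ne'⟩
  obtain ⟨Dm⟩ := hpar W
  obtain ⟨ϖ, hϖpos, hϖ, -⟩ := Dm.exists_rat_mul_realPeriodRat_eq_plusPeriod
  obtain ⟨L, hL⟩ := exists_isSplitMultPAdicLFunctionOf hsplit Dm.isNewformOf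
  obtain ⟨Dq⟩ := (nonempty_tateParameterData_iff_holds (W := W) (p := p)).mpr hsplit
  obtain ⟨Dh, hDh⟩ := hH W p hp2 Dq
  -- (MC=) with `μ = 0` for this data, from the shape (split clause)
  have hXt : D.IsTorsion := hMC.isTorsion hκ hγ hγ' Dm.isNewformOf D ϖ hϖpos.ne' hϖ
  obtain ⟨g, w, hchar, -, hw⟩ :=
    hMC.exists_charIdeal_eq_unit_split hκ hγ hγ' Dm.isNewformOf D ϖ hϖpos.ne' hϖ hsplit L hL
  -- (D) Disegni Thm. 1, split clause, at the pair
  obtain ⟨s, u', hs, hDis⟩ := hD Dm.isNewformOf ϖ hϖpos.ne' hϖ hp5 hm Dq L hL Dh hDh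
  exact bsdp_of_split_of_relativeLeadingTerm_of_schneider W p hJ hGZK hp2 hr Dq hκ hγ hγ' D hXt hchar
    w hw Dh hDh hs u' hDis (hSch Dq Dh hDh)

/-- **X11b at `p`, BOTH reduction signs: `BSD(E,p)` from the shape `MultiplicativeCharIdealMuZero W p`
for `(E, p)`, the PUBLISHED named facts (Stein–Wuthrich Thm. 6.1 ×2, §4.2 existence ×2, Disegni 2020
Thm. 1 `hD`, GZK, modularity) and the ONE per-pair input `RegulatorNonvanishingAt W p`; at a SPLIT `p`
Disegni's (∗) is the binder `hcorner` (`p ≥ 5` and a second multiplicative prime).** (ram) NOT used.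
This is the `¬Ram`-capable twin of `bsdp_of_leverLocus_of_regulatorNonvanishing`. CONDITIONAL;
nothing booked. [cite: EmertonPollackWeston2006, Cor. 5.1.4 (arXiv:math/0404484 p. 30)]
[cite: SteinWuthrich2013, Thm. 6.1, §4.2] [cite: Disegni2020, Thm. 1 (§1.2), hypothesis (∗)]
[cite: Miller2011LMS, Def. 1.1] -/
theorem bsdp_of_multCharIdealMuZero_of_regulatorNonvanishing (hJn : thm61_nonsplitMultiplicative)
    (hJs : thm61_splitMultiplicative) (hHn : exists_isMultCanonical) (hHs : exists_isSplitMultCanonical)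
    (hD : thm1_padicBSD_rankOne_multiplicative)
    (hGZK : rank_eq_analyticRank_of_analyticRank_le_one) (hpar : nonempty_modularParametrizationData)
    (hX : ClassX11b W p)
    (hcorner : W.HasSplitMultiplicativeReductionAtPrime p →
      5 ≤ p ∧ ∃ (m : ℕ) (_ : Fact m.Prime), m ≠ p ∧ W.HasMultiplicativeReductionAtPrime m)
    (hMC : MultiplicativeCharIdealMuZero W p) (hReg : RegulatorNonvanishingAt W p) :
    BSDp W p := by
  by_cases hsplit : W.HasSplitMultiplicativeReductionAtPrime p
  · obtain ⟨hp5, hm⟩ := hcorner hsplit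
    exact bsdp_of_multCharIdealMuZero_of_split_of_five_le_of_schneider W p hJs hHs hGZK hpar
      (fun hf ϖ hϖ0 hϖ hp5' hm' Dq L hL Dh hDh =>
        thm1_padicBSD_rankOne_multiplicative.split hD W p hX.2.1 hX.2.2.1 hX.1 hf ϖ hϖ0 hϖ hsplit hp5'
          hm' Dq L hL Dh hDh)
      hX hsplit hp5 hm hMC hReg.2
  · exact bsdp_of_multCharIdealMuZero_of_nonsplit_of_schneider W p hJn hHn hGZK hpar
      (fun hf ϖ hϖ0 hϖ q hq0 hq1 hqj L hL Dh hDh =>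
        thm1_padicBSD_rankOne_multiplicative.nonsplit hD W p hX.2.1 hX.2.2.1 hX.1 hf ϖ hϖ0 hϖ hsplit
          hq0 hq1 hqj L hL Dh hDh)
      hX hsplit hMC hReg.1

end Shape

/-! ### Partner-explicit forms: the two named facts of Emerton–Pollack–Weston (`p ≥ 5`) -/

section Transfer

variable (W : WeierstrassCurve ℚ) [W.IsElliptic] [W.IsGloballyMinimal] (p : ℕ) [Fact p.Prime]

/-- **CONGRUENCE TRANSPORT, good-ordinary partner (N8, `p ≥ 5`, analytic rank one, (ram) NOT
required): `BSD(E,p)` from PUBLISHED facts plus the per-pair inputs [a globally minimal `E₁` GOOD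
ORDINARY at `p`, a `Γ_ℚ`-isomorphism `E₁[p] ≃ E[p]`, the integral main-conjecture identity WITH
`μ = 0` for `(E₁, p)` (`h₁ : GoodOrdinaryCharIdealMuZero W₁ p`), at a split `p` a second multiplicative
prime of `E` (`hm`), and the pair's `RegulatorNonvanishingAt W p`].** Emerton–Pollack–Weston Cor.
5.1.4 (`hEPW`, fact `cor514_transfer_of_goodOrdinary`) moves `h₁` to `(E, p)` (irreducibility of
`E₁[p]` transported from `ClassX11b`); then `bsdp_of_multCharIdealMuZero_of_regulatorNonvanishing`.
The partner exists only if `E[p]` is finite at `p` (`p ∣ v_p(Δ_min)`). CONDITIONAL; nothing booked;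
nothing is closed until a partner, `h₁` and the regulator certificate are lane-certified.
[cite: EmertonPollackWeston2006, Cor. 5.1.4 and Thm. 5.1.3 (arXiv:math/0404484 p. 30)]
[cite: SteinWuthrich2013, Thm. 6.1, §4.2] [cite: Disegni2020, Thm. 1 (§1.2), hypothesis (∗)]
[cite: Miller2011LMS, Def. 1.1] -/
theorem bsdp_of_transfer_goodOrdinary_of_regulatorNonvanishing
    (hEPW : cor514_transfer_of_goodOrdinary) (hJn : thm61_nonsplitMultiplicative)
    (hJs : thm61_splitMultiplicative) (hHn : exists_isMultCanonical) (hHs : exists_isSplitMultCanonical)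
    (hD : thm1_padicBSD_rankOne_multiplicative)
    (hGZK : rank_eq_analyticRank_of_analyticRank_le_one) (hpar : nonempty_modularParametrizationData)
    (W₁ : WeierstrassCurve ℚ) [W₁.IsElliptic] [W₁.IsGloballyMinimal]
    (hp5 : 5 ≤ p) (hX : ClassX11b W p)
    (hm : W.HasSplitMultiplicativeReductionAtPrime p →
      ∃ (m : ℕ) (_ : Fact m.Prime), m ≠ p ∧ W.HasMultiplicativeReductionAtPrime m)
    (hgood₁ : W₁.HasGoodReductionAtPrime p) (hord₁ : ¬ (p : ℤ) ∣ W₁.frobeniusTrace p)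
    (hiso : ∃ e : geomTorsion W₁ (p : ℤ) ≃+ geomTorsion W (p : ℤ),
      ∀ (σ : Field.absoluteGaloisGroup ℚ) (P : geomTorsion W₁ (p : ℤ)), e (σ • P) = σ • e P)
    (h₁ : GoodOrdinaryCharIdealMuZero W₁ p) (hReg : RegulatorNonvanishingAt W p) : BSDp W p := by
  obtain ⟨e, he⟩ := hiso
  have hirr₁ : W₁.HasIrreducibleModPGaloisRep p :=
    hasIrreducibleModPGaloisRep_of_torsionIso_symm e he hX.2.2.2
  exact bsdp_of_multCharIdealMuZero_of_regulatorNonvanishing W p hJn hJs hHn hHs hD hGZK hpar hX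
    (fun hs => ⟨hp5, hm hs⟩) (hEPW W₁ W p hp5 hgood₁ hord₁ hX.2.2.1 ⟨e, he⟩ hirr₁ h₁) hReg

/-- **CONGRUENCE TRANSPORT, multiplicative partner (N8, `p ≥ 5`, analytic rank one): the same with
`E₁` MULTIPLICATIVE at `p` and `h₁ : MultiplicativeCharIdealMuZero W₁ p`** (fact
`cor514_transfer_of_multiplicative`; e.g. a (ram) curve `E₁` through Skinner's Thm. A + the certificate
"`μ^an = 0`", `multiplicativeCharIdealMuZero_of_thmA` — but (x11a gen 8, REFEREE R32.4 wording) for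
elliptic curves at `p ≥ 5` (ram) is a `ρ̄`-invariant, so a (ram) partner of a `¬Ram` curve does not
exist: this form serves a multiplicative partner whose identity is known otherwise, or a (ram) pair
read through a (ram) partner). CONDITIONAL; nothing booked.
[cite: EmertonPollackWeston2006, Cor. 5.1.4 and Thm. 5.1.3 (arXiv:math/0404484 p. 30)]
[cite: SteinWuthrich2013, Thm. 6.1, §4.2] [cite: Disegni2020, Thm. 1 (§1.2)] [cite: Miller2011LMS, Def. 1.1] -/
theorem bsdp_of_transfer_multiplicative_of_regulatorNonvanishing
    (hEPW : cor514_transfer_of_multiplicative) (hJn : thm61_nonsplitMultiplicative)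
    (hJs : thm61_splitMultiplicative) (hHn : exists_isMultCanonical) (hHs : exists_isSplitMultCanonical)
    (hD : thm1_padicBSD_rankOne_multiplicative)
    (hGZK : rank_eq_analyticRank_of_analyticRank_le_one) (hpar : nonempty_modularParametrizationData)
    (W₁ : WeierstrassCurve ℚ) [W₁.IsElliptic] [W₁.IsGloballyMinimal]
    (hp5 : 5 ≤ p) (hX : ClassX11b W p)
    (hm : W.HasSplitMultiplicativeReductionAtPrime p →
      ∃ (m : ℕ) (_ : Fact m.Prime), m ≠ p ∧ W.HasMultiplicativeReductionAtPrime m)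
    (hmult₁ : W₁.HasMultiplicativeReductionAtPrime p)
    (hiso : ∃ e : geomTorsion W₁ (p : ℤ) ≃+ geomTorsion W (p : ℤ),
      ∀ (σ : Field.absoluteGaloisGroup ℚ) (P : geomTorsion W₁ (p : ℤ)), e (σ • P) = σ • e P)
    (h₁ : MultiplicativeCharIdealMuZero W₁ p) (hReg : RegulatorNonvanishingAt W p) : BSDp W p := by
  obtain ⟨e, he⟩ := hiso
  have hirr₁ : W₁.HasIrreducibleModPGaloisRep p :=
    hasIrreducibleModPGaloisRep_of_torsionIso_symm e he hX.2.2.2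
  exact bsdp_of_multCharIdealMuZero_of_regulatorNonvanishing W p hJn hJs hHn hHs hD hGZK hpar hX
    (fun hs => ⟨hp5, hm hs⟩) (hEPW W₁ W p hp5 hmult₁ hX.2.2.1 ⟨e, he⟩ hirr₁ h₁) hReg

/-! ### THE transport lemma of record for N8's `¬Ram` atom: every binder published or finite -/

/-- **N8 = X11b at `p ≥ 5` (analytic rank one, `p ‖ N`, `E[p]` irreducible; (ram) NOT required — so in
particular the atom `ClassX11b ∧ ¬Ram`, 138 cells of the R196 ledger, 50 of them with a screened
partner row): `BSD(E,p)` from PUBLISHED named facts — Emerton–Pollack–Weston 2006 Cor. 5.1.4 (`hEPW`),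
Burungale–Castella–Skinner 2025 Thm. 1.1.2 (b) (`hB`), Stein–Wuthrich 2013 Thm. 6.1 ×2 + §4.2 ×2,
Disegni 2020 Thm. 1 (`hD`), GZK, modularity, Serre's open image (tree theorem behind
`X9.bigIm_of_surj`) — plus FINITE per-pair inputs: `ρ̄_{E,p}` onto (`hsurj`; census: 137/138), a
partner `E₁` good ordinary at `p` with a `Γ_ℚ`-isomorphism `E₁[p] ≃ E[p]` (`hiso`; Sturm-bound trace
certificate), ONE unit coefficient of `ϖ₁ · L_p(f_{E₁}, α)` (`hcert₁`, "`μ^an(E₁) = 0`"), at a split `p`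
a second multiplicative prime of `E` (`hm`), and the pair's `RegulatorNonvanishingAt W p` (`hReg`,
REG-MULT certificate).** The partner's rank and BSD status play no role. Chain:
`goodOrdinaryCharIdealMuZero_of_thm112b` (with (im) for `E₁` from `hsurj` transported along `hiso`,
`hasSurjectiveModNGaloisRep_of_torsionIso`, and `X9.bigIm_of_surj`) ⇒
`bsdp_of_transfer_goodOrdinary_of_regulatorNonvanishing`. CONDITIONAL; nothing booked; X11b stays
CONSTRUCTION-SHAPED; the lane decides what a certified row is worth.
[cite: EmertonPollackWeston2006, Cor. 5.1.4 and Thm. 5.1.3 (arXiv:math/0404484 p. 30)]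
[cite: BurungaleCastellaSkinner2025, Thm. 1.1.2 (b) (§1.1, p. 2)] [cite: SteinWuthrich2013, Thm. 6.1, §4.2]
[cite: Disegni2020, Thm. 1 (§1.2), hypothesis (∗)] [cite: Miller2011LMS, Def. 1.1] -/
theorem bsdp_of_goodOrdinaryPartner_of_surj_of_regulatorNonvanishing
    (hEPW : cor514_transfer_of_goodOrdinary) (hB : thm112b_charIdeal_eq_padicLFunction_integral)
    (hJn : thm61_nonsplitMultiplicative) (hJs : thm61_splitMultiplicative) (hHn : exists_isMultCanonical)
    (hHs : exists_isSplitMultCanonical) (hD : thm1_padicBSD_rankOne_multiplicative)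
    (hGZK : rank_eq_analyticRank_of_analyticRank_le_one) (hpar : nonempty_modularParametrizationData)
    (W₁ : WeierstrassCurve ℚ) [W₁.IsElliptic] [W₁.IsGloballyMinimal]
    (hp5 : 5 ≤ p) (hX : ClassX11b W p) (hsurj : Surj W p)
    (hm : W.HasSplitMultiplicativeReductionAtPrime p →
      ∃ (m : ℕ) (_ : Fact m.Prime), m ≠ p ∧ W.HasMultiplicativeReductionAtPrime m)
    (hgood₁ : W₁.HasGoodReductionAtPrime p) (hord₁ : ¬ (p : ℤ) ∣ W₁.frobeniusTrace p)
    (hiso : ∃ e : geomTorsion W₁ (p : ℤ) ≃+ geomTorsion W (p : ℤ),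
      ∀ (σ : Field.absoluteGaloisGroup ℚ) (P : geomTorsion W₁ (p : ℤ)), e (σ • P) = σ • e P)
    (hcert₁ : ∀ [NeZero (W₁.conductorNorm ℤ)] (f₁ : CuspForm (Gamma0 (W₁.conductorNorm ℤ)) 2),
        IsNewformOf W₁ f₁ → ∀ (ϖ : ℚ), (ϖ : ℝ) * W₁.realPeriodRat = plusPeriod f₁ →
      ∃ n : ℕ, ‖PowerSeries.coeff n
        (PowerSeries.C (ϖ : ℚ_[p]) * padicLFunction f₁ (unitRoot W₁ p : ℚ_[p]))‖ = 1)
    (hReg : RegulatorNonvanishingAt W p) : BSDp W p := by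
  obtain ⟨e, he⟩ := hiso
  have hirr₁ : W₁.HasIrreducibleModPGaloisRep p :=
    hasIrreducibleModPGaloisRep_of_torsionIso_symm e he hX.2.2.2
  have hsurj₁ : Surj W₁ p :=
    hasSurjectiveModNGaloisRep_of_torsionIso e.symm (torsionIso_symm_smul e he) hsurj
  have him₁ : BigIm W₁ p := X9.bigIm_of_surj W₁ p hp5 hsurj₁
  have h₁ : GoodOrdinaryCharIdealMuZero W₁ p :=
    goodOrdinaryCharIdealMuZero_of_thm112b hB W₁ p (by omega) ⟨hgood₁, hord₁⟩ hirr₁ him₁ hcert₁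
  exact bsdp_of_transfer_goodOrdinary_of_regulatorNonvanishing W p hEPW hJn hJs hHn hHs hD hGZK hpar W₁
    hp5 hX hm hgood₁ hord₁ ⟨e, he⟩ h₁ hReg

/-- **On the (ram) atom the transport is REDUNDANT but consistent**: a (ram) X11b pair at `p ≥ 3` with
the certificate "`μ^an(E) = 0`" (`hμ`, one unit coefficient of THE `p`-adic `L`-function of `E`)
satisfies the shape `MultiplicativeCharIdealMuZero W p` by Skinner 2016 Thm. A
(`multiplicativeCharIdealMuZero_of_thmA`) — so `bsdp_of_multCharIdealMuZero_of_regulatorNonvanishing`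
re-derives the lever's conclusion there, and a (ram) N8 pair is itself an admissible multiplicative
PARTNER (`bsdp_of_transfer_multiplicative_of_regulatorNonvanishing`) for any congruent X11b pair.
Bookkeeping; CONDITIONAL; nothing booked. [cite: Skinner2016PacificMC, Thm. A (§1), §3.2–3.3] -/
theorem multCharIdealMuZero_of_classX11b_of_ram_of_muCertificate
    (hA : thmA_charIdeal_multiplicative) (hX : ClassX11b W p) (hram : Ram W p)
    (hμ : ∀ {N : ℕ} [NeZero N] (f : CuspForm (Gamma0 N) 2), IsNewformOf W f →
      ∀ (ϖ : ℚ), ϖ ≠ 0 → (ϖ : ℝ) * W.realPeriodRat = plusPeriod f →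
        (W.HasSplitMultiplicativeReductionAtPrime p →
          ∃ L : PowerSeries ℚ_[p], IsSplitMultPAdicLFunctionOf f p L ∧
            ∃ n : ℕ, ‖PowerSeries.coeff n (PowerSeries.C ((ϖ : ℚ) : ℚ_[p]) * L)‖ = 1) ∧
        (¬ W.HasSplitMultiplicativeReductionAtPrime p →
          ∃ L : PowerSeries ℚ_[p], IsMultPAdicLFunctionOf f p (-1) L ∧
            ∃ n : ℕ, ‖PowerSeries.coeff n (PowerSeries.C ((ϖ : ℚ) : ℚ_[p]) * L)‖ = 1)) :
    MultiplicativeCharIdealMuZero W p := by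
  obtain ⟨-, hp2, hmult, hirr⟩ := hX
  have hpP : p.Prime := Fact.out
  have hp3 : 3 ≤ p := by
    rcases hpP.eq_two_or_odd' with h | h
    · exact absurd h hp2
    · have := hpP.two_le; omega
  exact multiplicativeCharIdealMuZero_of_thmA hA W p hp3 hmult hirr hram hμ

end Transfer

end Summit.BirchSwinnertonDyer.Rank1Residual.X11b.ClassClosure

end
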